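import Mathlib
import Summits.Ventures.PercRepro2.Inst8TypedK3
import Summits.Ventures.PercRepro2.S4NamedCert

/-!
# S4's other named objects are kernel theorems of row 2′TRI by the instance method
(blind cell PercRepro2, typer-1 g14)

From the certificates of `S4NamedCert.lean` and the bridge `Inst8TypedK3.lean`: `CovForm.TypedBases` and
(HCOV) on the `(6, 7)` target, on `Θ(o, b; a₁, a₂, u)` + `a₃` pendant and on the 5-cycle + `a₃` pendant
(each padded to ten edges by dummy edges `6–7` between two isolated fresh vertices; the named object is
the minor with the dummy edges pinned closed, which `TypedBases` quantifies over).  Together with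
`Tri10Theorem.lean`, all four named objects of S4-HARDSTEP §2.3 are instance theorems of the kernel by
one method.
-/

namespace Summit.Ventures.PercRepro2

namespace Inst8

/-- The `(6, 7)` target, edge by edge: `oa₁, oa₂, oa₃, a₁b, a₂u, a₃u, bu` + three dummies `6–7`. -/
lemma ends_tgt67 :
    ends tgt67 = ![s(0, 1), s(0, 2), s(0, 3), s(1, 4), s(2, 5), s(3, 5), s(4, 5), s(6, 7), s(6, 7),
      s(6, 7)] := by
  funext e
  fin_cases e <;> rfl

/-- `Θ(o, b; a₁, a₂, u)` + `a₃` pendant, edge by edge: `oa₁, a₁b, oa₂, a₂b, ou, ub, ua₃` + three dummies. -/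
lemma ends_thetaPend :
    ends thetaPend = ![s(0, 1), s(1, 4), s(0, 2), s(2, 4), s(0, 5), s(5, 4), s(5, 3), s(6, 7),
      s(6, 7), s(6, 7)] := by
  funext e
  fin_cases e <;> rfl

/-- The 5-cycle + `a₃` pendant, edge by edge: `a₁o, ob, ba₂, a₂u, ua₁, ua₃` + four dummies. -/
lemma ends_c5Pend :
    ends c5Pend = ![s(1, 0), s(0, 4), s(4, 2), s(2, 5), s(5, 1), s(5, 3), s(6, 7), s(6, 7), s(6, 7),
      s(6, 7)] := by
  funext e
  fin_cases e <;> rfl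

section Theorems

variable {R : Type*} [Field R] [LinearOrder R] [IsStrictOrderedRing R]

/-- **Row 2′TRI on the `(6, 7)` target** (every minor, every type map). -/
theorem typedBases_tgt67 : CovForm.TypedBases (R := R) (ends tgt67) 0 1 2 3 4 :=
  typedBases_of_cert tgt67 4 cert_tgt67

/-- **(HCOV) on the `(6, 7)` target** for every admissible weight vector. -/
theorem HCov_tgt67 (p : Fin 10 → R) (hp : IsProbVec p) : CovForm.HCov p (ends tgt67) 0 1 2 3 4 :=
  HCov_of_cert tgt67 4 cert_tgt67 p hp

/-- **Row 2′TRI on `Θ(o, b; a₁, a₂, u)` + `a₃` pendant** (every minor, every type map). -/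
theorem typedBases_thetaPend : CovForm.TypedBases (R := R) (ends thetaPend) 0 1 2 3 4 :=
  typedBases_of_cert thetaPend 4 cert_thetaPend

/-- **(HCOV) on `Θ(o, b; a₁, a₂, u)` + `a₃` pendant** for every admissible weight vector. -/
theorem HCov_thetaPend (p : Fin 10 → R) (hp : IsProbVec p) :
    CovForm.HCov p (ends thetaPend) 0 1 2 3 4 :=
  HCov_of_cert thetaPend 4 cert_thetaPend p hp

/-- **Row 2′TRI on the 5-cycle + `a₃` pendant** (every minor, every type map). -/
theorem typedBases_c5Pend : CovForm.TypedBases (R := R) (ends c5Pend) 0 1 2 3 4 :=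
  typedBases_of_cert c5Pend 4 cert_c5Pend

/-- **(HCOV) on the 5-cycle + `a₃` pendant** for every admissible weight vector. -/
theorem HCov_c5Pend (p : Fin 10 → R) (hp : IsProbVec p) : CovForm.HCov p (ends c5Pend) 0 1 2 3 4 :=
  HCov_of_cert c5Pend 4 cert_c5Pend p hp

end Theorems

end Inst8

end Summit.Ventures.PercRepro2
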